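import Summits.QuantumFields.QCD.Theses.TransparentRPWall
import Literature.MathematicalPhysics.QuantumFieldTheory.TiltedTorusLatticeSchwinger
import Literature.MathematicalPhysics.QuantumFieldTheory.QCDAsymptoticScalingCouplingDivergence
import Summits.QuantumFields.YangMills.Theorems.PencilRigidityDiagonalMirrorRPRStubRpClosureDefs
import Summits.QuantumFields.YangMills.Theorems.PencilRigidityDiagonalMirrorRPRStubRpClosureSupport
import Summits.QuantumFields.YangMills.Theorems.PencilRigidityDiagonalMirrorRPRStubRpClosureDensity
import HarnessLib.Audit

/-!
# `CoverWallRP` — birth skeleton (piece X_R of the BC2 redirect of `TransparentRPWall.WallDiagonalRP`, stmt-QuantumFields-10466)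

Crux-strategist planner-cstrat-stmt-QuantumFields-10466-r1-0, 2026-08-17.  Piece X_R = EXACT swap reflection positivity of the
WALL-MODIFIED lattice QCD on the FILS 45° cover, read on smeared species strings (Gram form on compactly supported real test
families in `{x₁ < x₀}`), eventually along any two-loop-AF scheme on the physical branch carrying a uniform lattice gap.

Stubs (the ONLY `sorry`s):
* `stub_exactWallTensorRP` — **THE HARD STUB (XL, finite-dimensional, TRUE as typed): exact RP at ONE lattice step.**  For
  `β_k ≥ 0`, bare masses `m_f(k) > −2` (`|κ_f| < 1/4`), `L_k ≥ 1` (two distinct walls `u = 0`, `u = N_k = 2L_k+1`) and every finite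
  family of real test functions charging only lattice sites with `x₀ − x₁ ≥ 2` (`tsupport ⊆ {2a_k ≤ y₀ − y₁}`; no compactness
  needed), the swap Gram matrix of the wall functional is Hermitian positive.  Intended proof = TRANSFER of the tree's AXIS
  site-reflection positivity of Wilson QCD (`Literature/…/QCDSiteReflectionPositivityProofs.lean`, Montvay–Münster (4.99)–(4.111),
  Osterwalder–Seiler 1978 §2) to the oblique wall: with `Γ₀ = +γ_n`, `Γ₁ = −γ_n` on wall-touching hops the positive side `u ≥ 1`
  couples to the wall layer only through `{½(1+γ_n)ψ_w, ψ̄_w ½(1−γ_n)}` and the negative side through the complementary components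
  (`γ₄ ↦ γ_n` in M–M's factorisation; in-wall hops only in directions 2,3 ⇒ `‖1 − B_σ‖ ≤ 4|κ|`), the gauge weight is swap-RP on the
  cover for `β ≥ 0` (LANDED: `TiltedTorus.integral_conj_swap_mul_weight_nonneg`, FILS Thm 2.1, pierced `(0,1)`-plaquettes cut
  along their diagonal), unnormalised Grassmann–Haar positivity `⟨Θ(A)A⟩ ≥ 0` for `A` in the closed-positive-half algebra, of
  which smeared species strings with `x₀ − x₁ ≥ 2` are members (glue plaquettes based at `u` reach `u ± 1`; `Θ(O_s(f)) = O_s(f∘swap)`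
  for all three species: `γ_n iγ₅† γ_n = iγ₅`, flavour swap absorbed by the hermitian combinations); division by `Z ≥ 0`
  (`Z = 0` ⇒ junk-zero functional, Gram = degree-0 block of ones, still positive).  Faces already on the route: `FreeWallRP`
  (U ≡ 1 one-particle kernel, kit j001443), the dropped `GaugeWallRP` (σ-symmetric SU(3) backgrounds, kit j001343/j001345) —
  cheapest falsifiers, not lemmas (the OS–Seiler argument does not go configuration by configuration).
* `stub_schemeWindow` — **scheme bookkeeping (S/M): eventually the scheme sits in the wall-RP window** `β_k ≥ 0 ∧ m_f(k) > −2 ∧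
  L_k ≥ 1`.  For `N_f ≤ 16` this is the Literature theorem `eventually_le_beta_of_hasAsymptoticScaling` + the branch clause +
  `a_k L_k → ∞`; for `N_f ≥ 17` (where two-loop "asymptotic scaling" forces `β_k → −∞`) it is exactly refuter R1's recorded
  over-generality of the UNGUARDED `∀ N_f` of the parent crux (evidence Guard.lean on stmt-10466), shielded here as there by the
  lattice-gap hypothesis at `β_k → −∞`; the planner-recommended guard `(N_f = 2 ∨ N_f = 3) →` on `WallDiagonalRP` would delete it.
* `CoverWallRP_of` — PROVED composition: a finite family of compactly supported test functions in the open half-space has a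
  uniform margin `δ > 0` (`y₀ − y₁ ≥ δ` on every support), and `a_k → 0` puts `2a_k ≤ δ` eventually.

-/

set_option autoImplicit false

noncomputable section

namespace Summit.QuantumFields.QCD.Cruxes.WallDiagonalRP.CoverWallRPBirth

open scoped BigOperators Topology Classical ComplexConjugate SchwartzMap
open Filter Set Function MeasureTheory
open Literature.MathematicalPhysics.QuantumLattice Literature.MathematicalPhysics.AQFT
  Literature.MathematicalPhysics.QuantumFieldTheory Literature.Probability.LatticeModels

/-! ## §0 Vocabulary (verbatim the inline `let`s of the route items, given names) -/

/-- Euclidean `ℝ⁴`, time = coordinate `0`. -/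
abbrev E4 : Type := EuclideanSpace ℝ (Fin 4)

/-- **The wall-modified lattice QCD `n`-point functional on the FILS 45° cover** `T̃_{N_k}`, `N_k = sch.side k`
(chart `(u,w,y,z) = (x₀−x₁, x₁, x₂, x₃)`, walls `u = 0` and `u = N_k`): Wilson's `SU(3)` plaquette weight on the cover,
`N_f` Wilson quarks (`r = 1`, bare masses `m_f(k)`) whose hops in directions `0, 1` touching a wall are re-spun
`γ₀ ↦ +γ_n`, `γ₁ ↦ −γ_n`, `γ_n = (γ₀ − γ₁)/√2`, Berezin-integrated; the same smeared, rescaled, renormalised species fields as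
`qcdLatticeSchwinger` (box `[-L_k, L_k]⁴ ⊂ ℤ⁴`, `z_s(k) a_k⁴ ∑ f(a_k x)(O_s(x) − shift_s(k))`, glue read through the
`Λ̃`-periodic lift, mesons at the cover site); normalised by its own partition function; `1` in degree `0`. VERBATIM the
`Wfun` of the route items `CoverWallRP` / `WallTransparency`. -/
def wallFun : (Nf : ℕ) → QCDScheme Nf → ℕ → (n : ℕ) → (Fin n → QCDField Nf) → (Fin n → 𝓢(E4, ℝ)) → ℂ :=
  let E := EuclideanSpace ℝ (Fin 4);
  let SU3 := ↥(Matrix.specialUnitaryGroup (Fin 3) ℂ);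
  let γn : Matrix (Fin 4) (Fin 4) ℂ := (((Real.sqrt 2)⁻¹ : ℝ) : ℂ) • (euclideanGamma 0 - euclideanGamma 1);
  fun Nf sch k n σ f =>
      (let T := TiltedTorus.Site (sch.side k);
       let C := TiltedTorus.Config (sch.side k) SU3;
       let ρ := fundamentalRep (Fin 3);
       let V := Fin Nf × (T × Fin 3 × Fin 4);
       let I := Fin (Fintype.card V);
       let e : V ≃ I := Fintype.equivFin V;
       let A := GrassmannAlgebra ℂ (I ⊕ₗ I);
       let wall : T → Prop := fun x => x.1 = 0 ∨ x.1 = ((sch.side k : ℕ) : ZMod (2 * sch.side k));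
       let Γ : Fin 4 → T → T → Matrix (Fin 4) (Fin 4) ℂ :=
         fun μ x y => if (μ = 0 ∨ μ = 1) ∧ (wall x ∨ wall y) then (if μ = 0 then γn else -γn) else euclideanGamma μ;
       let D : C → Matrix I I ℂ := fun U => Matrix.reindex e e (Matrix.of fun v w =>
         if v.1 = w.1 then
           ((if v.2 = w.2 then ((sch.mq v.1 k + 4 : ℝ) : ℂ) else 0) -
             (1 / 2 : ℂ) * ∑ μ : Fin 4,
               ((if w.2.1 = v.2.1 + TiltedTorus.step μ then
                   (1 - Γ μ v.2.1 w.2.1) v.2.2.2 w.2.2.2 * ρ (U (v.2.1, μ)) v.2.2.1 w.2.2.1 else 0) +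
                (if v.2.1 = w.2.1 + TiltedTorus.step μ then
                   (1 + Γ μ v.2.1 w.2.1) v.2.2.2 w.2.2.2 * ρ ((U (w.2.1, μ))⁻¹) v.2.2.1 w.2.2.1 else 0)))
         else 0);
       let boltz : C → A := fun U => grassmannExp (quadratic ℂ (-D U));
       let P : Fin Nf → Fin Nf → T → A := fun fl g x =>
         ∑ a : Fin 3, ∑ α : Fin 4, ∑ β : Fin 4,
           (Complex.I * gammaFive α β) • (psiBar ℂ (e (fl, (x, a, α))) * psi ℂ (e (g, (x, a, β))));
       let ins : C → QCDField Nf → Site 4 → A := fun U s x =>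
         let y := TiltedTorus.proj (sch.side k) x;
         match s with
         | .glue => algebraMap ℂ A ((actionDensity ρ (configShift (-x) (TiltedTorus.lift (sch.side k) U)) : ℝ) : ℂ)
         | .pseudoRe fl g => (1 / 2 : ℂ) • (P fl g y + P g fl y)
         | .pseudoIm fl g => (-Complex.I / 2) • (P fl g y - P g fl y);
       let sm : C → QCDField Nf → SchwartzMap E ℝ → A := fun U s h =>
         ∑ x ∈ box 4 (sch.L k), ((sch.z s k * sch.a k ^ 4 * h (sch.a k • siteToE x) : ℝ) : ℂ) •
           (ins U s x - algebraMap ℂ A ((sch.shift s k : ℝ) : ℂ));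
       let wt : C → ℂ := fun U => ((TiltedTorus.weight ρ (sch.β k) U : ℝ) : ℂ);
       let ber := GrassmannAlgebra.berezin ℂ (I ⊕ₗ I);
       let ν := (TiltedTorus.haar (sch.side k) : Measure C);
       if n = 0 then (1 : ℂ) else
         (∫ U, ber ((List.ofFn fun i => sm U (σ i) (f i)).prod * boltz U) * wt U ∂ν) /
           (∫ U, ber (boltz U) * wt U ∂ν))

/-- **The HONEST lattice QCD functional on the 45° cover** (no wall modification: `Γ_μ ≡ γ_μ`) — the same text with the wall
predicate `False`; the cover twin of `qcdLatticeSchwinger` (which lives on the cubic torus `ℤ⁴/(2L_k+1)ℤ⁴`). -/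
def coverFun : (Nf : ℕ) → QCDScheme Nf → ℕ → (n : ℕ) → (Fin n → QCDField Nf) → (Fin n → 𝓢(E4, ℝ)) → ℂ :=
  let E := EuclideanSpace ℝ (Fin 4);
  let SU3 := ↥(Matrix.specialUnitaryGroup (Fin 3) ℂ);
  let γn : Matrix (Fin 4) (Fin 4) ℂ := (((Real.sqrt 2)⁻¹ : ℝ) : ℂ) • (euclideanGamma 0 - euclideanGamma 1);
  fun Nf sch k n σ f =>
      (let T := TiltedTorus.Site (sch.side k);
       let C := TiltedTorus.Config (sch.side k) SU3;
       let ρ := fundamentalRep (Fin 3);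
       let V := Fin Nf × (T × Fin 3 × Fin 4);
       let I := Fin (Fintype.card V);
       let e : V ≃ I := Fintype.equivFin V;
       let A := GrassmannAlgebra ℂ (I ⊕ₗ I);
       let wall : T → Prop := fun x => x.1 = 0 ∨ x.1 = ((sch.side k : ℕ) : ZMod (2 * sch.side k));
       let Γ : Fin 4 → T → T → Matrix (Fin 4) (Fin 4) ℂ :=
         fun μ x y => if (μ = 0 ∨ μ = 1) ∧ (wall x ∨ wall y) then (if μ = 0 then γn else -γn) else euclideanGamma μ;
       let D : C → Matrix I I ℂ := fun U => Matrix.reindex e e (Matrix.of fun v w =>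
         if v.1 = w.1 then
           ((if v.2 = w.2 then ((sch.mq v.1 k + 4 : ℝ) : ℂ) else 0) -
             (1 / 2 : ℂ) * ∑ μ : Fin 4,
               ((if w.2.1 = v.2.1 + TiltedTorus.step μ then
                   (1 - Γ μ v.2.1 w.2.1) v.2.2.2 w.2.2.2 * ρ (U (v.2.1, μ)) v.2.2.1 w.2.2.1 else 0) +
                (if v.2.1 = w.2.1 + TiltedTorus.step μ then
                   (1 + Γ μ v.2.1 w.2.1) v.2.2.2 w.2.2.2 * ρ ((U (w.2.1, μ))⁻¹) v.2.2.1 w.2.2.1 else 0)))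
         else 0);
       let boltz : C → A := fun U => grassmannExp (quadratic ℂ (-D U));
       let P : Fin Nf → Fin Nf → T → A := fun fl g x =>
         ∑ a : Fin 3, ∑ α : Fin 4, ∑ β : Fin 4,
           (Complex.I * gammaFive α β) • (psiBar ℂ (e (fl, (x, a, α))) * psi ℂ (e (g, (x, a, β))));
       let ins : C → QCDField Nf → Site 4 → A := fun U s x =>
         let y := TiltedTorus.proj (sch.side k) x;
         match s with
         | .glue => algebraMap ℂ A ((actionDensity ρ (configShift (-x) (TiltedTorus.lift (sch.side k) U)) : ℝ) : ℂ)
         | .pseudoRe fl g => (1 / 2 : ℂ) • (P fl g y + P g fl y)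
         | .pseudoIm fl g => (-Complex.I / 2) • (P fl g y - P g fl y);
       let sm : C → QCDField Nf → SchwartzMap E ℝ → A := fun U s h =>
         ∑ x ∈ box 4 (sch.L k), ((sch.z s k * sch.a k ^ 4 * h (sch.a k • siteToE x) : ℝ) : ℂ) •
           (ins U s x - algebraMap ℂ A ((sch.shift s k : ℝ) : ℂ));
       let wt : C → ℂ := fun U => ((TiltedTorus.weight ρ (sch.β k) U : ℝ) : ℂ);
       let ber := GrassmannAlgebra.berezin ℂ (I ⊕ₗ I);
       let ν := (TiltedTorus.haar (sch.side k) : Measure C);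
       if n = 0 then (1 : ℂ) else
         (∫ U, ber ((List.ofFn fun i => sm U (σ i) (f i)).prod * boltz U) * wt U ∂ν) /
           (∫ U, ber (boltz U) * wt U ∂ν))

/-- The coordinate swap `x₀ ↔ x₁` on real test functions, `h ↦ h ∘ swap` (VERBATIM the `swapT` of the items). -/
def swapTest (h : 𝓢(E4, ℝ)) : 𝓢(E4, ℝ) :=
  SchwartzMap.compCLMOfContinuousLinearEquiv ℝ
    (LinearIsometryEquiv.piLpCongrLeft 2 ℝ ℝ (Equiv.swap (0 : Fin 4) 1)).toContinuousLinearEquiv h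

/-- **Swap Gram form** of a one-step real-tensor functional `Λ₁` on a finite family: term `(i, j)` pairs the string `i`
REVERSED, REFLECTED (`swapTest`) and with reversed labels against the string `j` — the lattice shadow of OS's
`𝔖(Θfᵢ* ⊗ fⱼ)` for real tensors, complex coefficients `cᵢ`. -/
def gram {ι : Type} (Λ₁ : (n : ℕ) → (Fin n → ι) → (Fin n → 𝓢(E4, ℝ)) → ℂ) (N : ℕ) (c : Fin N → ℂ) (deg : Fin N → ℕ)
    (lab : (j : Fin N) → Fin (deg j) → ι) (f : (j : Fin N) → Fin (deg j) → 𝓢(E4, ℝ)) : ℂ :=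
  ∑ i, ∑ j, starRingEnd ℂ (c i) * c j *
    Λ₁ (deg i + deg j) (Fin.append (lab i ∘ Fin.rev) (lab j)) (Fin.append (fun l => swapTest (f i (Fin.rev l))) (f j))

/-- **The hypothesis package of `WallTransparency`** (the clauses of the route's `W` it keeps: the OS package of `S`, the scheme
triple AF / physical branch / honest convergence to `S`, and the two gaps; translations and signed permutations of `S` are dropped —
honest limits have them anyway). -/
def TPkg (Nf : ℕ) (sch : QCDScheme Nf) (S : LabelledSchwingerFamily (QCDField Nf) E4) : Prop :=
  let E := EuclideanSpace ℝ (Fin 4);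
  (S.IsNormalized ∧ S.IsHermitian ∧ S.HasLinearGrowth ∧ S.IsReflectionPositive ∧ S.IsSymmetric ∧ S.HasClusterProperty) ∧
    (sch.HasAsymptoticScaling ∧ (∀ fl : Fin Nf, ∀ᶠ k in Filter.atTop, -1 < sch.mq fl k) ∧
      (∀ (n : ℕ), n ≠ 0 → ∀ (σ : Fin n → QCDField Nf) (f : Fin n → SchwartzMap E ℝ) (F : SchwartzMap (Fin n → E) ℂ),
        IsTensorOf F (fun i => ofRealTest (f i)) → IsOffDiagonal F →
          Filter.Tendsto (fun k : ℕ => qcdLatticeSchwinger sch k n σ f) Filter.atTop (nhds (S n σ F)))) ∧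
    (∃ Δ : ℝ, 0 < Δ ∧ S.HasMassGap Δ ∧ sch.HasLatticeMassGap Δ)

/-- The package `W Nf sch S` of the route (VERBATIM): E0, E0', E2, E3, E4, translations, proper signed permutations on `⁰𝒮`;
two-loop AF, physical branch, honest convergence; continuum + uniform lattice gap. -/
def WPkg (Nf : ℕ) (sch : QCDScheme Nf) (S : LabelledSchwingerFamily (QCDField Nf) E4) : Prop :=
  let E := EuclideanSpace ℝ (Fin 4);
  ((S.IsNormalized ∧ S.IsHermitian ∧ S.HasLinearGrowth ∧ S.IsReflectionPositive ∧ S.IsSymmetric ∧ S.HasClusterProperty ∧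
      (∀ (n : ℕ) (k : Fin n → QCDField Nf) (a : E) (F : SchwartzMap (Fin n → E) ℂ), IsOffDiagonal F → S n k (translateMulti a F) = S n k F) ∧
      (∀ (n : ℕ) (k : Fin n → QCDField Nf) (R : E ≃ₗᵢ[ℝ] E), LinearMap.det (R.toLinearEquiv : E →ₗ[ℝ] E) = 1 →
        (∀ i : Fin 4, ∃ j : Fin 4, R (EuclideanSpace.single i 1) = EuclideanSpace.single j 1 ∨ R (EuclideanSpace.single i 1) = -EuclideanSpace.single j 1) →
          ∀ F : SchwartzMap (Fin n → E) ℂ, IsOffDiagonal F → S n k (linActMulti R F) = S n k F)) ∧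
    (sch.HasAsymptoticScaling ∧ (∀ fl : Fin Nf, ∀ᶠ k in Filter.atTop, -1 < sch.mq fl k) ∧
      (∀ (n : ℕ), n ≠ 0 → ∀ (σ : Fin n → QCDField Nf) (f : Fin n → SchwartzMap E ℝ) (F : SchwartzMap (Fin n → E) ℂ),
        IsTensorOf F (fun i => ofRealTest (f i)) → IsOffDiagonal F →
          Filter.Tendsto (fun k : ℕ => qcdLatticeSchwinger sch k n σ f) Filter.atTop (nhds (S n σ F)))) ∧
    (∃ Δ : ℝ, 0 < Δ ∧ S.HasMassGap Δ ∧ sch.HasLatticeMassGap Δ))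

/-! ## §1 The registered stubs -/

/-- **THE HARD STUB (XL, TRUE as typed).** Exact swap tensor-RP of the wall functional at one lattice step inside the window
`β ≥ 0`, `m_f > −2`, `L ≥ 1`, for real test families charging only sites with `x₀ − x₁ ≥ 2`. -/
theorem stub_exactWallTensorRP :
    ∀ (Nf : ℕ) (sch : QCDScheme Nf) (k : ℕ), 0 ≤ sch.β k → (∀ fl : Fin Nf, -2 < sch.mq fl k) → 1 ≤ sch.L k →
      ∀ (N : ℕ) (c : Fin N → ℂ) (deg : Fin N → ℕ) (lab : (j : Fin N) → Fin (deg j) → QCDField Nf)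
        (f : (j : Fin N) → Fin (deg j) → 𝓢(E4, ℝ)),
        (∀ j l, tsupport (f j l : E4 → ℝ) ⊆ {y : E4 | 2 * sch.a k ≤ y 0 - y 1}) →
          0 ≤ (gram (wallFun Nf sch k) N c deg lab f).re ∧ (gram (wallFun Nf sch k) N c deg lab f).im = 0 := by
  sorry

/-- **Scheme bookkeeping (S/M; `N_f ≤ 16` from the Literature AF-divergence theorem; `N_f ≥ 17` = refuter R1's shielded
over-generality of the unguarded parent).** Eventually the scheme sits in the wall-RP window. -/
theorem stub_schemeWindow :
    ∀ (Nf : ℕ) (sch : QCDScheme Nf), sch.HasAsymptoticScaling → (∀ fl : Fin Nf, ∀ᶠ k in atTop, -1 < sch.mq fl k) →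
      (∃ Δ : ℝ, 0 < Δ ∧ sch.HasLatticeMassGap Δ) →
        ∀ᶠ k in atTop, 0 ≤ sch.β k ∧ (∀ fl : Fin Nf, -2 < sch.mq fl k) ∧ 1 ≤ sch.L k := by
  sorry

/-! ## §2 The piece, VERBATIM the route item, and the PROVED composition -/

/-- VERBATIM the statement filed as route item `TransparentRPWall.CoverWallRP`. -/
def CoverWallRPStmt : Prop :=
  open Literature.MathematicalPhysics.QuantumLattice Literature.MathematicalPhysics.AQFT Literature.MathematicalPhysics.QuantumFieldTheory Literature.Probability.LatticeModels in
  let E := EuclideanSpace ℝ (Fin 4);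
  let SU3 := ↥(Matrix.specialUnitaryGroup (Fin 3) ℂ);
  let γn : Matrix (Fin 4) (Fin 4) ℂ := (((Real.sqrt 2)⁻¹ : ℝ) : ℂ) • (euclideanGamma 0 - euclideanGamma 1);
  let Wfun : (Nf : ℕ) → QCDScheme Nf → ℕ → (n : ℕ) → (Fin n → QCDField Nf) → (Fin n → SchwartzMap E ℝ) → ℂ :=
    fun Nf sch k n σ f =>
      (let T := TiltedTorus.Site (sch.side k);
       let C := TiltedTorus.Config (sch.side k) SU3;
       let ρ := fundamentalRep (Fin 3);
       let V := Fin Nf × (T × Fin 3 × Fin 4);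
       let I := Fin (Fintype.card V);
       let e : V ≃ I := Fintype.equivFin V;
       let A := GrassmannAlgebra ℂ (I ⊕ₗ I);
       let wall : T → Prop := fun x => x.1 = 0 ∨ x.1 = ((sch.side k : ℕ) : ZMod (2 * sch.side k));
       let Γ : Fin 4 → T → T → Matrix (Fin 4) (Fin 4) ℂ :=
         fun μ x y => if (μ = 0 ∨ μ = 1) ∧ (wall x ∨ wall y) then (if μ = 0 then γn else -γn) else euclideanGamma μ;
       let D : C → Matrix I I ℂ := fun U => Matrix.reindex e e (Matrix.of fun v w =>
         if v.1 = w.1 then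
           ((if v.2 = w.2 then ((sch.mq v.1 k + 4 : ℝ) : ℂ) else 0) -
             (1 / 2 : ℂ) * ∑ μ : Fin 4,
               ((if w.2.1 = v.2.1 + TiltedTorus.step μ then
                   (1 - Γ μ v.2.1 w.2.1) v.2.2.2 w.2.2.2 * ρ (U (v.2.1, μ)) v.2.2.1 w.2.2.1 else 0) +
                (if v.2.1 = w.2.1 + TiltedTorus.step μ then
                   (1 + Γ μ v.2.1 w.2.1) v.2.2.2 w.2.2.2 * ρ ((U (w.2.1, μ))⁻¹) v.2.2.1 w.2.2.1 else 0)))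
         else 0);
       let boltz : C → A := fun U => grassmannExp (quadratic ℂ (-D U));
       let P : Fin Nf → Fin Nf → T → A := fun fl g x =>
         ∑ a : Fin 3, ∑ α : Fin 4, ∑ β : Fin 4,
           (Complex.I * gammaFive α β) • (psiBar ℂ (e (fl, (x, a, α))) * psi ℂ (e (g, (x, a, β))));
       let ins : C → QCDField Nf → Site 4 → A := fun U s x =>
         let y := TiltedTorus.proj (sch.side k) x;
         match s with
         | .glue => algebraMap ℂ A ((actionDensity ρ (configShift (-x) (TiltedTorus.lift (sch.side k) U)) : ℝ) : ℂ)
         | .pseudoRe fl g => (1 / 2 : ℂ) • (P fl g y + P g fl y)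
         | .pseudoIm fl g => (-Complex.I / 2) • (P fl g y - P g fl y);
       let sm : C → QCDField Nf → SchwartzMap E ℝ → A := fun U s h =>
         ∑ x ∈ box 4 (sch.L k), ((sch.z s k * sch.a k ^ 4 * h (sch.a k • siteToE x) : ℝ) : ℂ) •
           (ins U s x - algebraMap ℂ A ((sch.shift s k : ℝ) : ℂ));
       let wt : C → ℂ := fun U => ((TiltedTorus.weight ρ (sch.β k) U : ℝ) : ℂ);
       let ber := GrassmannAlgebra.berezin ℂ (I ⊕ₗ I);
       let ν := (TiltedTorus.haar (sch.side k) : Measure C);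
       if n = 0 then (1 : ℂ) else
         (∫ U, ber ((List.ofFn fun i => sm U (σ i) (f i)).prod * boltz U) * wt U ∂ν) /
           (∫ U, ber (boltz U) * wt U ∂ν));
  let swapT : SchwartzMap E ℝ → SchwartzMap E ℝ := fun h =>
    SchwartzMap.compCLMOfContinuousLinearEquiv ℝ
      (LinearIsometryEquiv.piLpCongrLeft 2 ℝ ℝ (Equiv.swap (0 : Fin 4) 1)).toContinuousLinearEquiv h;
  ∀ (Nf : ℕ) (sch : QCDScheme Nf), sch.HasAsymptoticScaling → (∀ fl : Fin Nf, ∀ᶠ k in Filter.atTop, -1 < sch.mq fl k) →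
    (∃ Δ : ℝ, 0 < Δ ∧ sch.HasLatticeMassGap Δ) →
      ∀ Λ : (ℕ → (n : ℕ) → (Fin n → QCDField Nf) → (Fin n → SchwartzMap E ℝ) → ℂ), Λ = (fun k n σ f => Wfun Nf sch k n σ f) →
      ∀ (N : ℕ) (c : Fin N → ℂ) (deg : Fin N → ℕ) (lab : (j : Fin N) → Fin (deg j) → QCDField Nf)
        (f : (j : Fin N) → Fin (deg j) → SchwartzMap E ℝ),
        (∀ j l, HasCompactSupport (f j l : E → ℝ) ∧ tsupport (f j l : E → ℝ) ⊆ {y : E | y 1 < y 0}) →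
          ∀ᶠ k in Filter.atTop,
            let z := ∑ i, ∑ j, starRingEnd ℂ (c i) * c j *
              Λ k (deg i + deg j) (Fin.append (lab i ∘ Fin.rev) (lab j))
                (Fin.append (fun l => swapT (f i (Fin.rev l))) (f j));
            0 ≤ z.re ∧ z.im = 0

/-- **Uniform margin.** A finite family of compactly supported functions in the open half-space `{y₁ < y₀}` keeps a uniform
distance: `y₀ − y₁ ≥ δ > 0` on every support. -/
theorem exists_uniform_margin {N : ℕ} {deg : Fin N → ℕ} (f : (j : Fin N) → Fin (deg j) → 𝓢(E4, ℝ))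
    (hf : ∀ j l, HasCompactSupport (f j l : E4 → ℝ) ∧ tsupport (f j l : E4 → ℝ) ⊆ {y : E4 | y 1 < y 0}) :
    ∃ δ : ℝ, 0 < δ ∧ ∀ j l, tsupport (f j l : E4 → ℝ) ⊆ {y : E4 | δ ≤ y 0 - y 1} := by
  -- one margin per support (compactness of the support, continuity of `y ↦ y₀ − y₁`)
  have hg : Continuous fun y : E4 => y 0 - y 1 := by fun_prop
  have hone : ∀ j l, ∃ δ : ℝ, 0 < δ ∧ tsupport (f j l : E4 → ℝ) ⊆ {y : E4 | δ ≤ y 0 - y 1} := by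
    intro j l
    obtain ⟨hK, hsub⟩ := hf j l
    by_cases hne : (tsupport (f j l : E4 → ℝ)).Nonempty
    · obtain ⟨x, hx, hmin⟩ := hK.exists_isMinOn hne hg.continuousOn
      refine ⟨x 0 - x 1, sub_pos.2 (hsub hx), fun y hy => ?_⟩
      exact hmin hy
    · refine ⟨1, one_pos, fun y hy => ?_⟩
      exact absurd ⟨y, hy⟩ hne
  choose δ hδ hsub using hone
  -- the minimum over the finite index type `Σ j, Fin (deg j)` (or `1` if it is empty)
  by_cases hP : Nonempty (Σ j : Fin N, Fin (deg j))
  · have huniv : (Finset.univ : Finset (Σ j : Fin N, Fin (deg j))).Nonempty := Finset.univ_nonempty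
    refine ⟨Finset.univ.inf' huniv fun p => δ p.1 p.2, ?_, fun j l y hy => ?_⟩
    · exact (Finset.lt_inf'_iff huniv).2 fun p _ => hδ p.1 p.2
    · have hle : (Finset.univ.inf' huniv fun p => δ p.1 p.2) ≤ δ j l :=
        Finset.inf'_le (fun p : Σ j : Fin N, Fin (deg j) => δ p.1 p.2) (Finset.mem_univ ⟨j, l⟩)
      exact le_trans hle (hsub j l hy)
  · refine ⟨1, one_pos, fun j l => ?_⟩
    exact absurd ⟨⟨j, l⟩⟩ hP

/-- **The piece from its stubs (PROVED).** -/
theorem CoverWallRP_of_stubs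
    (hExact : ∀ (Nf : ℕ) (sch : QCDScheme Nf) (k : ℕ), 0 ≤ sch.β k → (∀ fl : Fin Nf, -2 < sch.mq fl k) → 1 ≤ sch.L k →
      ∀ (N : ℕ) (c : Fin N → ℂ) (deg : Fin N → ℕ) (lab : (j : Fin N) → Fin (deg j) → QCDField Nf)
        (f : (j : Fin N) → Fin (deg j) → 𝓢(E4, ℝ)),
        (∀ j l, tsupport (f j l : E4 → ℝ) ⊆ {y : E4 | 2 * sch.a k ≤ y 0 - y 1}) →
          0 ≤ (gram (wallFun Nf sch k) N c deg lab f).re ∧ (gram (wallFun Nf sch k) N c deg lab f).im = 0)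
    (hWin : ∀ (Nf : ℕ) (sch : QCDScheme Nf), sch.HasAsymptoticScaling → (∀ fl : Fin Nf, ∀ᶠ k in atTop, -1 < sch.mq fl k) →
      (∃ Δ : ℝ, 0 < Δ ∧ sch.HasLatticeMassGap Δ) →
        ∀ᶠ k in atTop, 0 ≤ sch.β k ∧ (∀ fl : Fin Nf, -2 < sch.mq fl k) ∧ 1 ≤ sch.L k) :
    CoverWallRPStmt := by
  intro Nf sch hAF hbr hgap Λ hΛ N c deg lab f hf
  subst hΛ
  obtain ⟨δ, hδ, hsub⟩ := exists_uniform_margin f hf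
  have ha : ∀ᶠ k in atTop, sch.a k < δ / 2 := (tendsto_order.1 sch.tendsto_a).2 (δ / 2) (by positivity)
  filter_upwards [hWin Nf sch hAF hbr hgap, ha] with k hk hak
  obtain ⟨hβ, hm, hL⟩ := hk
  have h2 : 2 * sch.a k ≤ δ := by linarith
  exact hExact Nf sch k hβ hm hL N c deg lab f fun j l y hy => le_trans h2 (hsub j l hy)

/-- The local verbatim copy IS the route item (definitional). -/
theorem coverWallRPStmt_iff : CoverWallRPStmt ↔ Summit.QuantumFields.QCD.Theses.TransparentRPWall.CoverWallRP := Iff.rfl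

/-- **`CoverWallRP_of`**: the registered stubs imply the ROUTE ITEM BY NAME. -/
theorem CoverWallRP_of :
    (∀ (Nf : ℕ) (sch : QCDScheme Nf) (k : ℕ), 0 ≤ sch.β k → (∀ fl : Fin Nf, -2 < sch.mq fl k) → 1 ≤ sch.L k →
      ∀ (N : ℕ) (c : Fin N → ℂ) (deg : Fin N → ℕ) (lab : (j : Fin N) → Fin (deg j) → QCDField Nf)
        (f : (j : Fin N) → Fin (deg j) → 𝓢(E4, ℝ)),
        (∀ j l, tsupport (f j l : E4 → ℝ) ⊆ {y : E4 | 2 * sch.a k ≤ y 0 - y 1}) →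
          0 ≤ (gram (wallFun Nf sch k) N c deg lab f).re ∧ (gram (wallFun Nf sch k) N c deg lab f).im = 0) →
    (∀ (Nf : ℕ) (sch : QCDScheme Nf), sch.HasAsymptoticScaling → (∀ fl : Fin Nf, ∀ᶠ k in atTop, -1 < sch.mq fl k) →
      (∃ Δ : ℝ, 0 < Δ ∧ sch.HasLatticeMassGap Δ) →
        ∀ᶠ k in atTop, 0 ≤ sch.β k ∧ (∀ fl : Fin Nf, -2 < sch.mq fl k) ∧ 1 ≤ sch.L k) →
    Summit.QuantumFields.QCD.Theses.TransparentRPWall.CoverWallRP :=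
  fun h₁ h₂ => coverWallRPStmt_iff.1 (CoverWallRP_of_stubs h₁ h₂)

/-- **`CoverWallRP_proof`**: the route item from the registered stubs (closed modulo the two `stub_*`). -/
theorem CoverWallRP_proof : Summit.QuantumFields.QCD.Theses.TransparentRPWall.CoverWallRP :=
  CoverWallRP_of stub_exactWallTensorRP stub_schemeWindow

end Summit.QuantumFields.QCD.Cruxes.WallDiagonalRP.CoverWallRPBirth

end
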